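import Summits.NavierStokesRegularity.NavierStokesRegularity.Theorems.ScenarioCensusScrewBlowdownLPDuhamel
import HarnessLib

/-!
# LINE «screw-blowdown» port, part 11/13: the `LocalPersistence` appendix (c) — the bootstrap `one_step`, `persist`, `localPersistence` (LP PROVED);
# consequences in `…ScrewBlowdown`: `localPersistence_holds`, `farPastSpreading_holds`, `linearConeLiouville_holds`, `row_A13isqT_proved` (A13isq-T DECIDED)

Re-homed for the scenario census (typer seat ns-census-typer-1 g7; lead g9 RULINGS [7] 20:33Z / [8] 21:03Z / [12](b) 21:58Z: «screw-blowdown v1.8 =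
version of record; `Row_A13isqT` DECIDED IN KERNEL → CANDIDATE-DECIDED member under A13 (row already TREE); typer-1 slot 3 port of record =
`ScrewBlowdown_port_v1_8.lean` bb5f719a8be448dd (stub-free)»; lead g10 RULINGS [1](b) 22:36Z / [2] 22:42Z: «port v1.9 ffe1ad3d1d25e376 = port of record (idea-crit-3 DIFF-CHECK 22:40:40Z CONFORMS); slot 4 = its S3
appendix ADMISSIBLE after slot 3»; ref PRE-CHECKs items 13 / 15 / 20 / 27): VERBATIM PORT of ns-idea-4 LINE g12-1 «screw-blowdown» PORT copy
`pub/ideators/ns-idea-4/lines/screw-blowdown/port/ScrewBlowdown_port_v1_9.lean` sha16 ffe1ad3d1d25e376 (2890 l.; lean check rc 0, 0 sorry; = the v1.8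
port copy bb5f719a8be448dd as a literal prefix — itself the v1.7 copy 674e939b7b0b34e8 + the `LocalPersistence` attack appendix `…LP` + the consequences
`localPersistence_holds` / `farPastSpreading_holds` / `linearConeLiouville_holds` / `row_A13isqT_proved` — plus the v1.9 S3 block: `vanishingBlowdownLiouville_holds`,
`row_ArecT_proved`; parts 1–3 landed while v1.8 was the copy of record, text identical),
split for the 400-line rule into `ScenarioCensusScrewBlowdown` (§1–§3: objects, the cell `Row_A13isqT`, obligation Props, S1 PROVED) →
`…Plumbing` (§4, S2 PROVED) → `…Bridges` (§5 + v1.3) → `…Recurrent` (v1.4, `Row_ArecT`) → `…OffAxis` (v1.5 a) → `…Cone` (v1.5 b: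
`farPast_linearCone_smallness_of_screw`) → `…Residual` (v1.5 c + v1.6: `LinearConeLiouville`, DSS rungs) → `…Propagation` (v1.7: FS, LP,
reductions; the three class-general tools are NOT re-declared — taken BY NAME, general `E`, from `Theorems/TypeIAncientMildForwardUniqueness.lean`,
ns-idea-4 extract a1b589f6dec7da83, p671177) → `…LPTools` / `…LPDuhamel` / `…LP` (the appendix: Gaussian locality, the three-term Oseen split,
time weights; `duhamel_bound`; the bootstrap `one_step` / `persist` / `localPersistence` + the consequences incl. `row_A13isqT_proved`) →
`…Vanishing` (v1.9: S3 proved, `row_ArecT_proved`) → `…Keys` (census keys `Row_A13isqT` / `Row_ArecT` + `_excluded`).  Lean text VERBATIM in namespaces `…Theorems.ScenarioCensus.ScrewBlowdown` / `…ScrewBlowdownLP` (the line's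
`…Lines.ScrewBlowdownPort` / `…PortLP` re-homed; qualified references renamed accordingly); port edits: `local notation "E3"` → `abbrev E3` (the
appendix `open`s it), `@[conjecture]` on `VanishingBlowdownLiouville` only (part 1 landed while S3 was open; an obligation node, now with the closed
witness `vanishingBlowdownLiouville_holds`), seven one-line docstrings added, `continuous_rotZ_angle'` not re-declared (it restates the tree's
`Literature.Analysis.FluidPDE.continuous_rotZ_angle`, gate lint `dedup.landed`; its uses renamed), the line's `set_option linter.unusedVariables false` dropped (five proof lambdas
bind the unused `θ₀ h` as `_ _`; the unused hypothesis binders of `hasVanishingBlowdown_of_axiallyRecurrent` / `pointwise_small_of_zoom_small` are spelled `_hu` / `_hΛ`,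
statements otherwise identical); `set_option maxHeartbeats … in` of the appendix kept as in the line.

No census VALUE is moved by this file (row A13 is TREE already; the lead books the member A13isq-T); NS regularity is NOT proved; (L′)
`SymmetryModuliCount.TypeIAncientLiouville` is untouched (hypothesis of bridges only); no summit statement is proved by this file.
-/

-- the summit and its single problem share the name `NavierStokesRegularity` (D-0017 nested layout)
set_option linter.dupNamespace false

open MeasureTheory Filter Topology Real Set Metric
open Literature.Analysis Literature.Analysis.FluidPDE Literature.Analysis.UnboundedOperators

namespace Summit.NavierStokesRegularity.NavierStokesRegularity.Theorems.ScenarioCensus.ScrewBlowdownLP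

noncomputable section

open Summit.NavierStokesRegularity.NavierStokesRegularity.Theorems.ScenarioCensus.ScrewBlowdown (E3)

/-! ## Stage 3 — one step of the localised bootstrap

Restart the mild identity at `s₀`: `u(σ) = e^{(σ−s₀)Δ}u(s₀) − B¹_{s₀}(u,u)(σ)`.  The heat part is controlled by
Gaussian locality (`norm_heatExtension_le_of_ball`, inner radius `R/4`, global bound `K/√(−s₀)`), the Duhamel
part by `duhamel_bound`. -/

/-- the dimensional Gaussian constant `2^{d/2}` of `norm_heatExtension_le_of_ball` (here `d = 3`). -/
def gaussConst : ℝ := (2 : ℝ) ^ ((Module.finrank ℝ E3 : ℝ) / 2)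

/-- `0 < gaussConst`. -/
theorem gaussConst_pos : 0 < gaussConst := by unfold gaussConst; positivity

/-- `0 ≤ ρ(R, κ, τ)` for `R, κ ≥ 0`. -/
theorem rho_nonneg {R κ τ : ℝ} (hR : 0 ≤ R) (hκ : 0 ≤ κ) : 0 ≤ rho R κ τ := by
  unfold rho; positivity

/-- `ρ` is antitone in `τ`. -/
theorem rho_mono {R κ τ τ' : ℝ} (hκ : 0 ≤ κ) (h : τ ≤ τ') : rho R κ τ' ≤ rho R κ τ := by
  unfold rho
  have : Real.sqrt (-τ') ≤ Real.sqrt (-τ) := Real.sqrt_le_sqrt (by linarith)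
  nlinarith

set_option maxHeartbeats 800000 in
/-- **One step.**  Under the induction hypothesis on `(s₀, σ)` and the initial smallness on `B(x, R)`,
`R ≥ 4κ√(−s₀)`, the relative size at any `y ∈ B(x, ρ(σ))` is at most
`ε + 2^{d/2} K e^{−κ²/8} + (20 C₀ A² + 16 C₁ K²/(κ q²) + 2 C₀ K² q)`. -/
theorem one_step {C₁ : ℝ} (hC₁ : 0 < C₁)
    (hmix : ∀ {σ : ℝ}, 0 < σ → ∀ {a b : E3 → E3},
      AEStronglyMeasurable a volume → AEStronglyMeasurable b volume →
      ∀ {Ma Mb ma mb : ℝ} {x : E3} {r : ℝ}, 0 < r → 0 ≤ ma → ma ≤ Ma → 0 ≤ mb →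
      (∀ z, ‖a z‖ ≤ Ma) → (∀ z, ‖b z‖ ≤ Mb) →
      (∀ z, ‖x - z‖ < r → ‖a z‖ ≤ ma) → (∀ z, ‖x - z‖ < r → ‖b z‖ ≤ mb) →
        ‖oseenSlice σ a b x‖ ≤ oseenSliceConst E3 * σ ^ (-(1 / 2 : ℝ)) * ma * mb + 2 * (C₁ * Ma * Mb / r))
    {C K A q κ R ε s₀ σ : ℝ} {u : ℝ → E3 → E3} (hu : IsTypeIAncientMild C u) (hCK : C ≤ K) (hK1 : 1 ≤ K)
    (hA0 : 0 ≤ A) (hAK : 2 * A ≤ K) (hq : 0 < q) (hq1 : q ≤ 1) (hκ : 0 < κ) (hε : 0 ≤ ε)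
    (hs₀σ : s₀ < σ) (hσ : σ < 0) (hR : 4 * κ * Real.sqrt (-s₀) ≤ R) {x : E3}
    (hball : ∀ x' : E3, dist x' x ≤ R → Real.sqrt (-s₀) * ‖u s₀ x'‖ ≤ ε)
    (hind : ∀ τ ∈ Ioo s₀ σ, ∀ z : E3, dist z x ≤ rho R κ τ → Real.sqrt (-τ) * ‖u τ z‖ ≤ 2 * A)
    {y : E3} (hy : dist y x ≤ rho R κ σ) :
    Real.sqrt (-σ) * ‖u σ y‖ ≤ ε + gaussConst * K * Real.exp (-(κ ^ 2 / 8)) +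
      (20 * oseenSliceConst E3 * A ^ 2 + 16 * C₁ * K ^ 2 / (κ * q ^ 2) + 2 * oseenSliceConst E3 * K ^ 2 * q) := by
  have hs₀ : s₀ < 0 := hs₀σ.trans hσ
  have hs0 : 0 < -s₀ := by linarith
  have hσ0 : 0 < -σ := by linarith
  have hss₀ : 0 < Real.sqrt (-s₀) := Real.sqrt_pos.2 hs0
  have hsσ : 0 < Real.sqrt (-σ) := Real.sqrt_pos.2 hσ0
  have hK0 : 0 < K := by linarith
  have hκs : 0 ≤ κ * Real.sqrt (-s₀) := by positivity
  have hR0 : 0 ≤ R := by linarith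
  have hG0 : 0 < gaussConst := gaussConst_pos
  -- the restarted mild identity
  have hmild := hu.mild_eq_heatExtension hs₀σ hσ y
  -- heat part
  have hM : ∀ z, ‖u s₀ z‖ ≤ K / Real.sqrt (-s₀) := fun z =>
    (hu.norm_le hs₀ z).trans (div_le_div_of_nonneg_right hCK hss₀.le)
  have hρσ : rho R κ σ ≤ 3 * R / 4 := by
    unfold rho
    have : κ * Real.sqrt (-σ) ≤ κ * Real.sqrt (-s₀) :=
      mul_le_mul_of_nonneg_left (Real.sqrt_le_sqrt (by linarith)) hκ.le
    linarith
  have hAloc : ∀ w : E3, ‖w‖ ≤ R / 4 → ‖u s₀ (y - w)‖ ≤ ε / Real.sqrt (-s₀) := by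
    intro w hw
    have hd : dist (y - w) x ≤ R := by
      have h1 : dist (y - w) x ≤ dist (y - w) y + dist y x := dist_triangle _ _ _
      have h2 : dist (y - w) y = ‖w‖ := by rw [dist_eq_norm, sub_sub_cancel_left, norm_neg]
      linarith
    have := hball (y - w) hd
    rw [le_div_iff₀ hss₀, mul_comm]; exact this
  have hheat := norm_heatExtension_le_of_ball (f := u s₀) (x := y) (τ := σ - s₀) (by linarith)
    (by positivity) (by positivity) (by positivity : (0:ℝ) ≤ R / 4) hM hAloc
  have hexp : Real.exp (-((R / 4) ^ 2 / (8 * (σ - s₀)))) ≤ Real.exp (-(κ ^ 2 / 8)) := by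
    apply Real.exp_le_exp.2
    have h1 : κ ^ 2 * (-s₀) ≤ (R / 4) ^ 2 := by
      have : (κ * Real.sqrt (-s₀)) ^ 2 ≤ (R / 4) ^ 2 := pow_le_pow_left₀ hκs (by linarith) 2
      rw [mul_pow, Real.sq_sqrt hs0.le] at this; exact this
    have h8 : 0 < 8 * (σ - s₀) := by linarith
    have h2 : κ ^ 2 / 8 ≤ (R / 4) ^ 2 / (8 * (σ - s₀)) := by
      rw [div_le_div_iff₀ (by norm_num) h8]
      nlinarith [sq_nonneg κ]
    linarith
  have hratio : Real.sqrt (-σ) / Real.sqrt (-s₀) ≤ 1 :=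
    (div_le_one hss₀).2 (Real.sqrt_le_sqrt (by linarith))
  have hratio0 : 0 ≤ Real.sqrt (-σ) / Real.sqrt (-s₀) := by positivity
  have hheat' : Real.sqrt (-σ) * ‖heatExtension (u s₀) (σ - s₀) y‖ ≤
      ε + gaussConst * K * Real.exp (-(κ ^ 2 / 8)) := by
    have h1 : Real.sqrt (-σ) * ‖heatExtension (u s₀) (σ - s₀) y‖ ≤
        Real.sqrt (-σ) * (ε / Real.sqrt (-s₀) +
          gaussConst * (K / Real.sqrt (-s₀)) * Real.exp (-((R / 4) ^ 2 / (8 * (σ - s₀))))) :=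
      mul_le_mul_of_nonneg_left hheat hsσ.le
    have h2 : Real.sqrt (-σ) * (ε / Real.sqrt (-s₀) +
          gaussConst * (K / Real.sqrt (-s₀)) * Real.exp (-((R / 4) ^ 2 / (8 * (σ - s₀))))) =
        ε * (Real.sqrt (-σ) / Real.sqrt (-s₀)) +
          gaussConst * K * Real.exp (-((R / 4) ^ 2 / (8 * (σ - s₀)))) * (Real.sqrt (-σ) / Real.sqrt (-s₀)) := by
      ring
    have h3 : ε * (Real.sqrt (-σ) / Real.sqrt (-s₀)) ≤ ε := mul_le_of_le_one_right hε hratio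
    have h4 : gaussConst * K * Real.exp (-((R / 4) ^ 2 / (8 * (σ - s₀)))) * (Real.sqrt (-σ) / Real.sqrt (-s₀))
        ≤ gaussConst * K * Real.exp (-(κ ^ 2 / 8)) := by
      have h5 : gaussConst * K * Real.exp (-((R / 4) ^ 2 / (8 * (σ - s₀)))) * (Real.sqrt (-σ) / Real.sqrt (-s₀))
          ≤ gaussConst * K * Real.exp (-((R / 4) ^ 2 / (8 * (σ - s₀)))) :=
        mul_le_of_le_one_right (by positivity) hratio
      have h6 : gaussConst * K * Real.exp (-((R / 4) ^ 2 / (8 * (σ - s₀)))) ≤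
          gaussConst * K * Real.exp (-(κ ^ 2 / 8)) := mul_le_mul_of_nonneg_left hexp (by positivity)
      exact h5.trans h6
    linarith
  -- Duhamel part
  have hduh := duhamel_bound hC₁ hmix hu hCK hK1 hA0 hAK hq hq1 hκ hs₀σ hσ hind hy
  have hduh' : Real.sqrt (-σ) * ‖oseenDuhamel 1 s₀ u u σ y‖ ≤
      20 * oseenSliceConst E3 * A ^ 2 + 16 * C₁ * K ^ 2 / (κ * q ^ 2) + 2 * oseenSliceConst E3 * K ^ 2 * q := by
    have := mul_le_mul_of_nonneg_left hduh hsσ.le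
    rwa [mul_div_cancel₀ _ hsσ.ne'] at this
  -- combine
  have hnorm : ‖u σ y‖ ≤ ‖heatExtension (u s₀) (σ - s₀) y‖ + ‖oseenDuhamel 1 s₀ u u σ y‖ := by
    rw [hmild]; exact norm_sub_le _ _
  have := mul_le_mul_of_nonneg_left hnorm hsσ.le
  rw [mul_add] at this
  linarith

/-! ## Stage 4 — the continuous induction and the theorem -/

set_option maxHeartbeats 800000 in
/-- **Persistence by continuous induction.**  If one step always lands strictly below the threshold `3A/2`
(and the initial data is below it), the threshold is never reached on the shrinking balls; in particular at
`(t, x)`. The bad set is compact (continuity of `u` on `(−∞,0) × ℝ³`), so it has a first time, where one step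
contradicts badness. -/
theorem persist {C₁ : ℝ} (hC₁ : 0 < C₁)
    (hmix : ∀ {σ : ℝ}, 0 < σ → ∀ {a b : E3 → E3},
      AEStronglyMeasurable a volume → AEStronglyMeasurable b volume →
      ∀ {Ma Mb ma mb : ℝ} {x : E3} {r : ℝ}, 0 < r → 0 ≤ ma → ma ≤ Ma → 0 ≤ mb →
      (∀ z, ‖a z‖ ≤ Ma) → (∀ z, ‖b z‖ ≤ Mb) →
      (∀ z, ‖x - z‖ < r → ‖a z‖ ≤ ma) → (∀ z, ‖x - z‖ < r → ‖b z‖ ≤ mb) →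
        ‖oseenSlice σ a b x‖ ≤ oseenSliceConst E3 * σ ^ (-(1 / 2 : ℝ)) * ma * mb + 2 * (C₁ * Ma * Mb / r))
    {C K A q κ R ε s₀ t : ℝ} {u : ℝ → E3 → E3} (hu : IsTypeIAncientMild C u) (hCK : C ≤ K) (hK1 : 1 ≤ K)
    (hA : 0 < A) (hAK : 2 * A ≤ K) (hq : 0 < q) (hq1 : q ≤ 1) (hκ : 0 < κ) (hε : 0 ≤ ε)
    (hs₀t : s₀ < t) (ht : t < 0) (hR : 4 * κ * Real.sqrt (-s₀) ≤ R) {x : E3}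
    (hball : ∀ x' : E3, dist x' x ≤ R → Real.sqrt (-s₀) * ‖u s₀ x'‖ ≤ ε)
    (hsmall : ε + gaussConst * K * Real.exp (-(κ ^ 2 / 8)) +
      (20 * oseenSliceConst E3 * A ^ 2 + 16 * C₁ * K ^ 2 / (κ * q ^ 2) + 2 * oseenSliceConst E3 * K ^ 2 * q)
        < 3 * A / 2)
    (hε32 : ε < 3 * A / 2) :
    Real.sqrt (-t) * ‖u t x‖ < 3 * A / 2 := by
  have hs₀ : s₀ < 0 := hs₀t.trans ht
  have hs0 : 0 < -s₀ := by linarith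
  have hκs : 0 ≤ κ * Real.sqrt (-s₀) := by positivity
  have hR0 : 0 ≤ R := by linarith
  -- the relative size and the bad set
  set V : ℝ × E3 → ℝ := fun p => Real.sqrt (-p.1) * ‖u p.1 p.2‖ with hV
  set Bad : Set (ℝ × E3) := {p | p.1 ∈ Icc s₀ t ∧ dist p.2 x ≤ rho R κ p.1 ∧ 3 * A / 2 ≤ V p} with hBad
  have hS : IsClosed (Icc s₀ t ×ˢ (univ : Set E3)) := isClosed_Icc.prod isClosed_univ
  have hVcont : ContinuousOn V (Icc s₀ t ×ˢ (univ : Set E3)) := by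
    have h1 : ContinuousOn (fun p : ℝ × E3 => ‖Function.uncurry u p‖) (Icc s₀ t ×ˢ univ) := by
      refine (hu.continuousOn_uncurry.mono ?_).norm
      intro p hp
      rw [mem_prod] at hp ⊢
      exact ⟨lt_of_le_of_lt hp.1.2 ht, mem_univ _⟩
    have h2 : Continuous (fun p : ℝ × E3 => Real.sqrt (-p.1)) := continuous_fst.neg.sqrt
    exact h2.continuousOn.mul h1
  have hBad_closed : IsClosed Bad := by
    have h1 : IsClosed ((Icc s₀ t ×ˢ (univ : Set E3)) ∩ V ⁻¹' (Ici (3 * A / 2))) :=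
      hVcont.preimage_isClosed_of_isClosed hS isClosed_Ici
    have h2 : IsClosed {p : ℝ × E3 | dist p.2 x ≤ rho R κ p.1} := by
      apply isClosed_le (continuous_snd.dist continuous_const)
      unfold rho
      exact continuous_const.add (continuous_const.mul continuous_fst.neg.sqrt)
    have h3 : Bad = ((Icc s₀ t ×ˢ (univ : Set E3)) ∩ V ⁻¹' (Ici (3 * A / 2))) ∩
        {p : ℝ × E3 | dist p.2 x ≤ rho R κ p.1} := by
      ext p
      simp only [hBad, mem_setOf_eq, mem_inter_iff, mem_prod, mem_univ, and_true, mem_preimage, mem_Ici]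
      tauto
    rw [h3]; exact h1.inter h2
  have hBad_cpt : IsCompact Bad := by
    refine ((isCompact_Icc (a := s₀) (b := t)).prod
      (isCompact_closedBall x (rho R κ s₀))).of_isClosed_subset hBad_closed ?_
    intro p hp
    rw [mem_prod, mem_closedBall]
    exact ⟨hp.1, hp.2.1.trans (rho_mono hκ.le hp.1.1)⟩
  -- suppose the conclusion fails: then `(t, x)` is bad
  by_contra hcon
  push Not at hcon
  have htx : ((t, x) : ℝ × E3) ∈ Bad := by
    refine ⟨⟨hs₀t.le, le_rfl⟩, ?_, ?_⟩
    · show dist x x ≤ rho R κ t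
      rw [dist_self]; exact rho_nonneg hR0 hκ.le
    · exact hcon
  have hne : Bad.Nonempty := ⟨_, htx⟩
  -- the first bad time
  set T : Set ℝ := Prod.fst '' Bad with hT
  have hT_cpt : IsCompact T := hBad_cpt.image continuous_fst
  have hT_ne : T.Nonempty := hne.image _
  have hT_bdd : BddBelow T := hT_cpt.bddBelow
  obtain ⟨p, hpBad, hp1⟩ := hT_cpt.sInf_mem hT_ne
  have hσ_ge : s₀ ≤ p.1 := hpBad.1.1
  have hσ_le : p.1 ≤ t := hpBad.1.2
  have hσ_lt0 : p.1 < 0 := lt_of_le_of_lt hσ_le ht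
  have hρp : dist p.2 x ≤ rho R κ p.1 := hpBad.2.1
  have hVp : 3 * A / 2 ≤ Real.sqrt (-p.1) * ‖u p.1 p.2‖ := hpBad.2.2
  -- it is not the initial time
  have hσ_gt : s₀ < p.1 := by
    rcases eq_or_lt_of_le hσ_ge with h | h
    · exfalso
      have hρ0 : rho R κ s₀ ≤ R := by unfold rho; linarith
      have hd : dist p.2 x ≤ R := by rw [← h] at hρp; exact hρp.trans hρ0
      have hv := hball p.2 hd
      rw [h] at hv
      linarith
    · exact h
  -- below the first bad time the induction hypothesis holds
  have hind : ∀ τ ∈ Ioo s₀ p.1, ∀ z : E3, dist z x ≤ rho R κ τ → Real.sqrt (-τ) * ‖u τ z‖ ≤ 2 * A := by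
    intro τ hτ z hz
    by_contra hlt
    push Not at hlt
    have hmem : ((τ, z) : ℝ × E3) ∈ Bad :=
      ⟨⟨hτ.1.le, hτ.2.le.trans hσ_le⟩, hz, by show 3 * A / 2 ≤ Real.sqrt (-τ) * ‖u τ z‖; linarith⟩
    have hτT : τ ∈ T := ⟨(τ, z), hmem, rfl⟩
    have : p.1 ≤ τ := by rw [hp1]; exact csInf_le hT_bdd hτT
    linarith [hτ.2]
  -- one step at the first bad point contradicts badness
  have hstep := one_step hC₁ hmix hu hCK hK1 hA.le hAK hq hq1 hκ hε hσ_gt hσ_lt0 hR hball hind hρp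
  linarith

set_option maxHeartbeats 800000 in
/-- **Local persistence of smallness in the Type-I ancient mild class** (`ScrewBlowdown.LocalPersistence`,
referenced BY NAME): PROVED.  Constants: `K = max C 1`, `A = min(ε′/2, 1/(160 C₀), 1/2)`,
`ε = A/4`, `q = min(1/2, A/(16 C₀ K²))`, `κ = 128 C₁K²/(A q²) + 64·2^{d/2}K/A + 1`, `Λ = 4κ`. -/
theorem localPersistence : ScrewBlowdown.LocalPersistence := by
  intro C ε' hε'
  obtain ⟨C₁, hC₁, hmix⟩ := exists_norm_oseenSlice_le_mixed (E := E3)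
  have hC₀pos : 0 < oseenSliceConst E3 := oseenSliceConst_pos
  set C₀ : ℝ := oseenSliceConst E3 with hC₀
  set G : ℝ := gaussConst with hG
  have hG0 : 0 < G := gaussConst_pos
  set K : ℝ := max C 1 with hK
  have hK1 : 1 ≤ K := le_max_right _ _
  have hCK : C ≤ K := le_max_left _ _
  have hK0 : 0 < K := by linarith
  set A : ℝ := min (min (ε' / 2) (1 / (160 * C₀))) (1 / 2) with hA
  have hA0 : 0 < A := lt_min (lt_min (by linarith) (by positivity)) (by norm_num)
  have hAε : A ≤ ε' / 2 := (min_le_left _ _).trans (min_le_left _ _)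
  have hAC₀ : A ≤ 1 / (160 * C₀) := (min_le_left _ _).trans (min_le_right _ _)
  have hA12 : A ≤ 1 / 2 := min_le_right _ _
  have hAK : 2 * A ≤ K := by linarith
  set q : ℝ := min (1 / 2) (A / (16 * C₀ * K ^ 2)) with hq
  have hq0 : 0 < q := lt_min (by norm_num) (by positivity)
  have hq1 : q ≤ 1 := (min_le_left _ _).trans (by norm_num)
  have hqA : q ≤ A / (16 * C₀ * K ^ 2) := min_le_right _ _
  set κ : ℝ := 128 * C₁ * K ^ 2 / (A * q ^ 2) + 64 * G * K / A + 1 with hκ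
  have hκa0 : 0 ≤ 128 * C₁ * K ^ 2 / (A * q ^ 2) := by positivity
  have hκb0 : 0 ≤ 64 * G * K / A := by positivity
  have hκ1 : 1 ≤ κ := by linarith
  have hκ0 : 0 < κ := by linarith
  have hκa : 128 * C₁ * K ^ 2 / (A * q ^ 2) ≤ κ := by linarith
  have hκb : 64 * G * K / A ≤ κ := by linarith
  refine ⟨A / 4, by positivity, 4 * κ, by positivity, ?_⟩
  intro u hu s₀ t x R hs₀t ht hΛR hball
  have hs₀ : s₀ < t := by linarith
  -- the four numerical facts behind the choice of constants
  have n1 : 20 * C₀ * A ^ 2 ≤ A / 8 := by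
    have h1 : A * (160 * C₀) ≤ 1 := by rwa [le_div_iff₀ (by positivity)] at hAC₀
    nlinarith [hA0, hC₀pos]
  have n2 : 2 * C₀ * K ^ 2 * q ≤ A / 8 := by
    have h1 : q * (16 * C₀ * K ^ 2) ≤ A := by rwa [le_div_iff₀ (by positivity)] at hqA
    nlinarith [hK0, hC₀pos]
  have n3 : 16 * C₁ * K ^ 2 / (κ * q ^ 2) ≤ A / 8 := by
    have h1 : 128 * C₁ * K ^ 2 ≤ κ * (A * q ^ 2) := by rwa [div_le_iff₀ (by positivity)] at hκa
    rw [div_le_div_iff₀ (by positivity) (by norm_num)]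
    nlinarith [h1]
  have n4 : G * K * Real.exp (-(κ ^ 2 / 8)) ≤ A / 8 := by
    have h1 : Real.exp (-(κ ^ 2 / 8)) ≤ 8 / κ := by
      rw [Real.exp_neg]
      have h2 : κ ^ 2 / 8 + 1 ≤ Real.exp (κ ^ 2 / 8) := Real.add_one_le_exp _
      have h3 : κ / 8 ≤ κ ^ 2 / 8 + 1 := by nlinarith
      calc (Real.exp (κ ^ 2 / 8))⁻¹ ≤ (κ / 8)⁻¹ := inv_anti₀ (by positivity) (h3.trans h2)
        _ = 8 / κ := by rw [inv_div]
    have h4 : 64 * G * K ≤ κ * A := by rwa [div_le_iff₀ hA0] at hκb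
    calc G * K * Real.exp (-(κ ^ 2 / 8)) ≤ G * K * (8 / κ) := mul_le_mul_of_nonneg_left h1 (by positivity)
      _ = 8 * G * K / κ := by ring
      _ ≤ A / 8 := by rw [div_le_div_iff₀ hκ0 (by norm_num)]; nlinarith [h4]
  have hsmall : A / 4 + G * K * Real.exp (-(κ ^ 2 / 8)) +
      (20 * C₀ * A ^ 2 + 16 * C₁ * K ^ 2 / (κ * q ^ 2) + 2 * C₀ * K ^ 2 * q) < 3 * A / 2 := by linarith
  have hmain := persist hC₁ hmix hu hCK hK1 hA0 hAK hq0 hq1 hκ0 (by positivity : (0:ℝ) ≤ A / 4) hs₀ ht hΛR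
    hball hsmall (by linarith)
  linarith

end

end Summit.NavierStokesRegularity.NavierStokesRegularity.Theorems.ScenarioCensus.ScrewBlowdownLP

namespace Summit.NavierStokesRegularity.NavierStokesRegularity.Theorems.ScenarioCensus.ScrewBlowdown

/-! ## port v1.8 — consequences of the proved `LocalPersistence` (sorry-free file) -/

/-- **LP `LocalPersistence` — PROVED** (the appendix `ScrewBlowdownLP.localPersistence`). -/
theorem localPersistence_holds : LocalPersistence := ScrewBlowdownLP.localPersistence

/-- **FS `FarPastSpreading` — PROVED** (from LP). -/
theorem farPastSpreading_holds : FarPastSpreading :=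
  farPastSpreading_of_localPersistence localPersistence_holds

/-- **S3-lin `LinearConeLiouville` — PROVED** (from FS). -/
theorem linearConeLiouville_holds : LinearConeLiouville :=
  linearConeLiouville_of_farPastSpreading farPastSpreading_holds

/-- **Row A13isq^T — DECIDED (sorry-free standalone port file; standard axioms).** -/
theorem row_A13isqT_proved : Row_A13isqT := row_A13isqT_of_localPersistence localPersistence_holds

end Summit.NavierStokesRegularity.NavierStokesRegularity.Theorems.ScenarioCensus.ScrewBlowdown
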